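import Summits.CriticalPhenomena.SAWScalingLimit.Theorems.SAWDefectDecoherenceBoundaryClosureRRootWedgeStation
import HarnessLib

/-!
# The root wedge: the rim bound (crux `BoundaryClosureR`, stmt-CriticalPhenomena-14004, line
`pick-half-plane`, stub `stub_rootWedgeOfNoMax`)

Support file (topic: the two-sided bound `δ‖H t − H s_b‖ ≤ B‖F(b δ)‖` for the developing map at
ALL sites `t` above the root's floor in the thin annulus `r/2 < ‖δ t − x‖ ≤ r/2 + δ`):
`rim_station` (for a grid point `z` of the upper half-annulus `0.44r ≤ ‖z − x‖ ≤ 0.56r`,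
`im z ≥ im x + r/100`, the bound at every site of row `≥ mr δ` within `r/50` of `z`: `station_bound`
plus `pinned_link` of radius `r/50` in the root's pinned half-ball); `rim_cover` (every point of the
thin upper half-annulus lies within `r/50` of one of finitely many grid points); `rim_bound`;
`norm_sub_le_one_of_mem_siteNbrs`, `floorFaces_near` (lattice geometry at the exits).  Bookkeeping
around Duminil-Copin–Smirnov 2012, §4 (the map `H` with `dH = F dz`).
-/

noncomputable section

open scoped Topology
open Filter Set
open Literature.Probability.LatticeModels Literature.Probability.RandomPlanarGeometry
open Literature.Probability.RandomPlanarGeometry.SAW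
open Summit.CriticalPhenomena.SAWScalingLimit.Theorems.PickHalfPlane.DevelopingMaps

namespace Summit.CriticalPhenomena.SAWScalingLimit.Theorems.PickHalfPlane.RootWedge

/-! ### The rim stations -/

/-- **Two-sided bound at a rim station.**  For a point `z` with `0.44 r ≤ ‖z − x‖ ≤ 0.56 r`,
`im z ≥ im x + r/100`: for ONE `B ≥ 0`, eventually, `δ‖H t − H s_b‖ ≤ B‖F(b δ)‖` for every site
`t` of row `≥ mr δ` with `‖δ t − z‖ ≤ r/50` (`station_bound` at a site within `2δ` of `z`, plus
`pinned_link` of radius `r/50` about `z`, compact `{im ≥ im x} ∩ closedBall z (39r/100)`).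
[cite: DuminilCopinSmirnov2012, §4 (the map H with dH = F dz)] -/
theorem rim_station {D : DobrushinDomain} {ρ : ℝ} {Λ : ℝ → Finset HexVertex} {m : ℝ → ℤ}
    {b : ℝ → Sym2 HexVertex}
    (hAF : 0 < ρ ∧
      D.carrier ∩ Metric.ball (D.pt 1) ρ = {z : ℂ | (D.pt 1).im < z.im} ∩ Metric.ball (D.pt 1) ρ ∧
      (∀ᶠ δ : ℝ in 𝓝[>] 0, hexDomainSimplyConnected (Λ δ) ∧ b δ ∈ hexDomainBoundary (Λ δ) ∧
        (hexGraph.induce ((Λ δ : Finset HexVertex) : Set HexVertex)).Preconnected ∧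
        (∀ v ∈ Λ δ, (δ : ℂ) * hexCenter v ∈ D.carrier) ∧
        (∀ v : HexVertex, (δ : ℂ) * hexCenter v ∈ Metric.ball (D.pt 1) ρ →
          (v ∈ Λ δ ↔ m δ ≤ v.1 1))) ∧
      (∀ K : Set ℂ, IsCompact K → K ⊆ D.carrier →
        ∀ᶠ δ : ℝ in 𝓝[>] 0, ∀ v : HexVertex, (δ : ℂ) * hexCenter v ∈ K → v ∈ Λ δ) ∧
      Tendsto (fun δ : ℝ => (δ : ℂ) * hexMidpoint (b δ)) (𝓝[>] 0) (𝓝 (D.pt 1)))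
    {x : ℂ} {e : ℝ → Sym2 HexVertex} {r : ℝ} {mr : ℝ → ℤ}
    (hPR : 0 < r ∧ D.carrier ∩ Metric.ball x r = {z : ℂ | x.im < z.im} ∩ Metric.ball x r ∧
      (∀ᶠ δ : ℝ in 𝓝[>] 0, e δ ∈ hexDomainBoundary (Λ δ) ∧
        Nonempty (HexMidEdgeSAW (Λ δ) (e δ) (b δ)) ∧
        (∀ v : HexVertex, (δ : ℂ) * hexCenter v ∈ Metric.ball x r → (v ∈ Λ δ ↔ mr δ ≤ v.1 1))) ∧
      Tendsto (fun δ : ℝ => (δ : ℂ) * hexMidpoint (e δ)) (𝓝[>] 0) (𝓝 x))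
    (hx : x ≠ D.pt 1)
    (hSup : ∀ K : Set ℂ, IsCompact K →
      K ⊆ D.carrier ∪ (({z : ℂ | z.im = (D.pt 1).im} ∩ Metric.ball (D.pt 1) ρ) ∪
        ({z : ℂ | z.im = x.im} ∩ Metric.ball x r)) → x ∉ K →
      ∃ C : ℝ, ∀ᶠ δ : ℝ in 𝓝[>] 0, ∀ z ∈ hexDomainMidEdges (Λ δ), (δ : ℂ) * hexMidpoint z ∈ K →
        ‖hexParafermionicObservable (Λ δ) (e δ) hexCriticalFugacity (5 / 8) z‖ ≤
          C * ‖hexParafermionicObservable (Λ δ) (e δ) hexCriticalFugacity (5 / 8) (b δ)‖)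
    {z : ℂ} (hz1 : 44 * (r / 100) ≤ ‖z - x‖) (hz2 : ‖z - x‖ ≤ 56 * (r / 100))
    (hzim : x.im + r / 100 ≤ z.im) :
    ∃ B : ℝ, 0 ≤ B ∧ ∀ᶠ δ : ℝ in 𝓝[>] 0, ∀ H : Site 2 → ℂ, IsPotential (Λ δ) (e δ) H →
      ∀ ub wb : HexVertex, b δ = s(ub, wb) →
      ∀ sb : Site 2, sb ∈ hexFaceVertices ub → sb ∈ hexFaceVertices wb →
      ∀ t : Site 2, mr δ ≤ t 1 → ‖(δ : ℂ) * triEmbed t - z‖ ≤ r / 50 →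
        δ * ‖H t - H sb‖ ≤ B * ‖hexParafermionicObservable (Λ δ) (e δ) hexCriticalFugacity (5 / 8) (b δ)‖ := by
  have hr : 0 < r := hPR.1
  have hz : z ∈ D.carrier := by
    have h1 : z ∈ {w : ℂ | x.im < w.im} ∩ Metric.ball x r :=
      ⟨by show x.im < z.im; linarith, by rw [Metric.mem_ball, dist_eq_norm]; linarith⟩
    rw [← hPR.2.1] at h1
    exact h1.1
  obtain ⟨B₁, η₁, hB₁, hη₁, hQ⟩ := station_bound hAF hPR hx hSup hz
  -- the compact at the station and its sup-law constant
  set Kz : Set ℂ := {w : ℂ | x.im ≤ w.im} ∩ Metric.closedBall z (39 * (r / 100)) with hKz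
  have hKzc : IsCompact Kz :=
    (isCompact_closedBall z _).inter_left (isClosed_le continuous_const Complex.continuous_im)
  have hKzsub : Kz ⊆ D.carrier ∪ (({z : ℂ | z.im = (D.pt 1).im} ∩ Metric.ball (D.pt 1) ρ) ∪
      ({z : ℂ | z.im = x.im} ∩ Metric.ball x r)) := by
    rintro w ⟨hwim, hwz⟩
    have hwball : w ∈ Metric.ball x r := by
      rw [Metric.mem_ball, dist_eq_norm]
      have h1 := Metric.mem_closedBall.1 hwz
      rw [dist_eq_norm] at h1
      calc ‖w - x‖ ≤ ‖w - z‖ + ‖z - x‖ := norm_sub_le_norm_sub_add_norm_sub _ _ _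
        _ < r := by linarith
    rcases (show x.im ≤ w.im from hwim).lt_or_eq with hlt | heq
    · have h1 : w ∈ D.carrier ∩ Metric.ball x r := by rw [hPR.2.1]; exact ⟨hlt, hwball⟩
      exact Or.inl h1.1
    · exact Or.inr (Or.inr ⟨heq.symm, hwball⟩)
  have hxKz : x ∉ Kz := fun h => by
    have h1 := Metric.mem_closedBall.1 h.2
    rw [dist_comm, dist_eq_norm] at h1
    linarith
  obtain ⟨C, hC⟩ := hSup Kz hKzc hKzsub hxKz
  set C' : ℝ := max C 0 with hC'def
  have hC'0 : 0 ≤ C' := le_max_right _ _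
  refine ⟨B₁ + 6 * C' * (r / 25), by positivity, ?_⟩
  obtain ⟨_, _, hev, _, _⟩ := hAF
  have hframe := pinned_frame (Ω := D.carrier) (bf := e) hr (by positivity : (0 : ℝ) < r / 200)
    hPR.2.1 (hPR.2.2.1.mono fun δ h => h.2.2) (hPR.2.2.1.mono fun δ h => h.1)
    (hev.mono fun δ h => h.2.2.2.1) hPR.2.2.2
  have hFb : ∀ᶠ δ : ℝ in 𝓝[>] 0,
      hexParafermionicObservable (Λ δ) (e δ) hexCriticalFugacity (5 / 8) (b δ) ≠ 0 :=
    (LocalL1.eventually_normaliser_ne_zero_of_bundles hev hPR.2.2.1).mono fun δ h => h.1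
  have hδev : ∀ᶠ δ : ℝ in 𝓝[>] 0, δ ∈ Set.Ioo 0 (min (η₁ / 2) (r / 400)) :=
    Ioo_mem_nhdsGT (lt_min (half_pos hη₁) (by positivity))
  filter_upwards [hQ, hC, hPR.2.2.1, hframe, hFb, hδev] with δ hQδ hCδ hpinδ hfrδ hFbδ hδI H hH ub wb hb sb
    hsbu hsbw t ht1 ht
  obtain ⟨_, _, hpin⟩ := hpinδ
  obtain ⟨_, _, hlow, hht⟩ := hfrδ
  obtain ⟨hδ0, hδlt⟩ := hδI
  have hδη₁ : δ ≤ η₁ / 2 := hδlt.le.trans (min_le_left _ _)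
  have hδr : δ ≤ r / 400 := hδlt.le.trans (min_le_right _ _)
  set M : ℤ := mr δ with hM
  set Fb := hexParafermionicObservable (Λ δ) (e δ) hexCriticalFugacity (5 / 8) (b δ)
  -- the station site
  obtain ⟨sz, hsz⟩ := exists_site_near hδ0 z
  have hsz1 : M ≤ sz 1 := by
    have him : z.im - 2 * δ ≤ ((δ : ℂ) * triEmbed sz).im := by
      have h := Complex.abs_im_le_norm ((δ : ℂ) * triEmbed sz - z)
      rw [Complex.sub_im] at h
      have := (abs_le.1 (h.trans hsz)).1
      linarith
    have hsv : sz = ![sz 0, sz 1] := by ext i; fin_cases i <;> simp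
    rw [im_real_mul, hsv, im_triEmbed_vec2] at him
    have hlt : δ * ((M : ℝ) * (Real.sqrt 3 / 2)) < δ * ((sz 1 : ℝ) * (Real.sqrt 3 / 2)) := by
      have := (abs_lt.1 hht).2; nlinarith
    have h3 : (0 : ℝ) < Real.sqrt 3 / 2 := by positivity
    have := lt_of_mul_lt_mul_left hlt hδ0.le
    have : (M : ℝ) < sz 1 := lt_of_mul_lt_mul_right this h3.le
    exact_mod_cast this.le
  have hQ' : δ * ‖H sz - H sb‖ ≤ B₁ * ‖Fb‖ := hQδ H hH ub wb hb sb hsbu hsbw sz (by linarith)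
  -- the local link about the station
  have hlink := pinned_link (K := Kz) (x := x) (z := z) (r := r) (η := r / 50) (M := M) hδ0
    (by linarith) hC'0 hpin hlow
    (fun w hw => ⟨hw.1, Metric.closedBall_subset_closedBall (by linarith) hw.2⟩) (by linarith)
    (fun w hw hwK => (hCδ w hw hwK).trans (mul_le_mul_of_nonneg_right (le_max_left _ _) (norm_nonneg _)))
    ht1 hsz1 ht (by linarith) hH
  have hdist : ‖(δ : ℂ) * triEmbed sz - (δ : ℂ) * triEmbed t‖ ≤ r / 50 + 2 * δ := by
    calc ‖(δ : ℂ) * triEmbed sz - (δ : ℂ) * triEmbed t‖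
        = ‖((δ : ℂ) * triEmbed sz - z) - ((δ : ℂ) * triEmbed t - z)‖ := by ring_nf
      _ ≤ ‖(δ : ℂ) * triEmbed sz - z‖ + ‖(δ : ℂ) * triEmbed t - z‖ := norm_sub_le _ _
      _ ≤ r / 50 + 2 * δ := by linarith
  have h1 : δ * ‖H sz - H t‖ ≤ 6 * C' * (r / 25) * ‖Fb‖ := by
    have h := mul_norm_le_of_norm_div_le hδ0.le hFbδ hlink
    refine h.trans (mul_le_mul_of_nonneg_right ?_ (norm_nonneg _))
    have h6 : 0 ≤ 6 * C' := by positivity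
    nlinarith [mul_le_mul_of_nonneg_left (show ‖(δ : ℂ) * triEmbed sz - (δ : ℂ) * triEmbed t‖ + δ
      ≤ r / 25 by linarith) h6]
  calc δ * ‖H t - H sb‖ = δ * ‖(H t - H sz) + (H sz - H sb)‖ := by ring_nf
    _ ≤ δ * (‖H t - H sz‖ + ‖H sz - H sb‖) := mul_le_mul_of_nonneg_left (norm_add_le _ _) hδ0.le
    _ = δ * ‖H sz - H t‖ + δ * ‖H sz - H sb‖ := by rw [mul_add, norm_sub_rev]
    _ ≤ 6 * C' * (r / 25) * ‖Fb‖ + B₁ * ‖Fb‖ := add_le_add h1 hQ'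
    _ = (B₁ + 6 * C' * (r / 25)) * ‖Fb‖ := by ring

/-! ### Covering the rim by stations -/

/-- **The rim is covered by the grid stations.**  Every point `w` of the thin upper half-annulus
`r/2 < ‖w − x‖ ≤ r/2 + r/100`, `im w ≥ im x − r/200` lies within `r/50` of a grid point
`x + (r/100)(a + bi)` with `|a| ≤ 60`, `1 ≤ b ≤ 60`, `44² ≤ a² + b² ≤ 56²` (round the coordinates
of `100(w − x)/r`, pushing the row index up to `1`). [folklore] -/
theorem rim_cover : ∀ (x w : ℂ) (r : ℝ), 0 < r → r / 2 < ‖w - x‖ → ‖w - x‖ ≤ r / 2 + r / 100 →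
    x.im - r / 200 ≤ w.im → ∃ a b : ℤ, -60 ≤ a ∧ a ≤ 60 ∧ 1 ≤ b ∧ b ≤ 60 ∧ 44 ^ 2 ≤ a ^ 2 + b ^ 2 ∧
      a ^ 2 + b ^ 2 ≤ 56 ^ 2 ∧ ‖w - (x + (r / 100 : ℝ) * ((a : ℂ) + (b : ℂ) * Complex.I))‖ ≤ r / 50 := by
  intro x w r hr h1 h2 h3
  set u : ℂ := ((100 / r : ℝ) : ℂ) * (w - x) with hu
  have hr100 : (0 : ℝ) < 100 / r := by positivity
  have hnu : ‖u‖ = 100 / r * ‖w - x‖ := by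
    rw [hu, norm_mul, Complex.norm_real, Real.norm_of_nonneg hr100.le]
  have hu1 : 50 < ‖u‖ := by
    rw [hnu]
    have : 100 / r * (r / 2) = 50 := by field_simp; ring
    rw [← this]; exact mul_lt_mul_of_pos_left h1 hr100
  have hu2 : ‖u‖ ≤ 51 := by
    rw [hnu]
    have : 100 / r * (r / 2 + r / 100) = 51 := by field_simp; ring
    rw [← this]; exact mul_le_mul_of_nonneg_left h2 hr100.le
  have huim : -(1 / 2 : ℝ) ≤ u.im := by
    rw [hu, im_real_mul, Complex.sub_im]
    have : 100 / r * (-(r / 200)) = -(1 / 2 : ℝ) := by field_simp; ring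
    rw [← this]; exact mul_le_mul_of_nonneg_left (by linarith) hr100.le
  set a : ℤ := round u.re with ha
  set b : ℤ := max 1 (round u.im) with hb
  have hare : |u.re - a| ≤ 1 / 2 := abs_sub_round _
  have hbim : |u.im - b| ≤ 3 / 2 := by
    rcases le_or_gt 1 (round u.im) with h | h
    · rw [hb, max_eq_right h]
      exact (abs_sub_round _).trans (by norm_num)
    · rw [hb, max_eq_left h.le]
      have hlt : u.im < 1 / 2 := by
        have h0 : round u.im ≤ 0 := by omega
        rw [round_eq] at h0
        have := Int.floor_le_iff.1 h0
        push_cast at this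
        linarith
      rw [abs_le]; push_cast; constructor <;> linarith
  have hv : ‖u - ((a : ℂ) + (b : ℂ) * Complex.I)‖ ≤ 2 := by
    refine (Complex.norm_le_abs_re_add_abs_im _).trans ?_
    have e1 : (u - ((a : ℂ) + (b : ℂ) * Complex.I)).re = u.re - a := by simp
    have e2 : (u - ((a : ℂ) + (b : ℂ) * Complex.I)).im = u.im - b := by simp
    rw [e1, e2]; linarith
  -- the grid point is near `w`
  have hw : w - (x + (r / 100 : ℝ) * ((a : ℂ) + (b : ℂ) * Complex.I)) =
      ((r / 100 : ℝ) : ℂ) * (u - ((a : ℂ) + (b : ℂ) * Complex.I)) := by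
    rw [hu, mul_sub, ← mul_assoc, ← Complex.ofReal_mul, show r / 100 * (100 / r) = 1 by
      field_simp, Complex.ofReal_one, one_mul]
    ring
  have hnorm_ab : |‖u‖ - ‖(a : ℂ) + (b : ℂ) * Complex.I‖| ≤ 2 :=
    (abs_norm_sub_norm_le _ _).trans hv
  have hab1 : 48 ≤ ‖(a : ℂ) + (b : ℂ) * Complex.I‖ := by have := (abs_le.1 hnorm_ab).2; linarith
  have hab2 : ‖(a : ℂ) + (b : ℂ) * Complex.I‖ ≤ 53 := by have := (abs_le.1 hnorm_ab).1; linarith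
  have hsq : ‖(a : ℂ) + (b : ℂ) * Complex.I‖ ^ 2 = (a : ℝ) ^ 2 + (b : ℝ) ^ 2 := by
    rw [← Complex.normSq_eq_norm_sq]
    have := Complex.normSq_add_mul_I (a : ℝ) (b : ℝ)
    push_cast at this ⊢
    exact this
  have hlo : (44 : ℝ) ^ 2 ≤ (a : ℝ) ^ 2 + (b : ℝ) ^ 2 := by rw [← hsq]; nlinarith
  have hhi : (a : ℝ) ^ 2 + (b : ℝ) ^ 2 ≤ (56 : ℝ) ^ 2 := by rw [← hsq]; nlinarith [norm_nonneg ((a : ℂ) + (b : ℂ) * Complex.I)]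
  have haabs : |(a : ℝ)| ≤ 53 :=
    (Complex.abs_re_le_norm ((a : ℂ) + (b : ℂ) * Complex.I)).trans' (by simp) |>.trans hab2
  have hbabs : |(b : ℝ)| ≤ 53 :=
    (Complex.abs_im_le_norm ((a : ℂ) + (b : ℂ) * Complex.I)).trans' (by simp) |>.trans hab2
  have hb1 : 1 ≤ b := le_max_left _ _
  refine ⟨a, b, ?_, ?_, hb1, ?_, ?_, ?_, ?_⟩
  · have := (abs_le.1 haabs).1; exact_mod_cast (by linarith : (-60 : ℝ) ≤ a)
  · have := (abs_le.1 haabs).2; exact_mod_cast (by linarith : (a : ℝ) ≤ 60)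
  · have := (abs_le.1 hbabs).2; exact_mod_cast (by linarith : (b : ℝ) ≤ 60)
  · exact_mod_cast hlo
  · exact_mod_cast hhi
  · rw [hw, norm_mul, Complex.norm_real, Real.norm_of_nonneg (by positivity)]
    nlinarith

/-! ### The rim bound -/

/-- **The rim bound.**  For ONE `B ≥ 0`, eventually as `δ → 0+`: for every potential `H` of the
root-`e δ` observable, every normaliser site `s_b` and every site `t` of row `≥ mr δ` in the thin
annulus `r/2 < ‖δ t − x‖ ≤ r/2 + δ`, `δ‖H t − H s_b‖ ≤ B‖F(b δ)‖` — finitely many rim stations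
(`rim_station` at the grid points of `rim_cover`), one constant each, summed. [cite: DuminilCopinSmirnov2012, §4 (the map H with dH = F dz)] -/
theorem rim_bound {D : DobrushinDomain} {ρ : ℝ} {Λ : ℝ → Finset HexVertex} {m : ℝ → ℤ}
    {b : ℝ → Sym2 HexVertex}
    (hAF : 0 < ρ ∧
      D.carrier ∩ Metric.ball (D.pt 1) ρ = {z : ℂ | (D.pt 1).im < z.im} ∩ Metric.ball (D.pt 1) ρ ∧
      (∀ᶠ δ : ℝ in 𝓝[>] 0, hexDomainSimplyConnected (Λ δ) ∧ b δ ∈ hexDomainBoundary (Λ δ) ∧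
        (hexGraph.induce ((Λ δ : Finset HexVertex) : Set HexVertex)).Preconnected ∧
        (∀ v ∈ Λ δ, (δ : ℂ) * hexCenter v ∈ D.carrier) ∧
        (∀ v : HexVertex, (δ : ℂ) * hexCenter v ∈ Metric.ball (D.pt 1) ρ →
          (v ∈ Λ δ ↔ m δ ≤ v.1 1))) ∧
      (∀ K : Set ℂ, IsCompact K → K ⊆ D.carrier →
        ∀ᶠ δ : ℝ in 𝓝[>] 0, ∀ v : HexVertex, (δ : ℂ) * hexCenter v ∈ K → v ∈ Λ δ) ∧
      Tendsto (fun δ : ℝ => (δ : ℂ) * hexMidpoint (b δ)) (𝓝[>] 0) (𝓝 (D.pt 1)))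
    {x : ℂ} {e : ℝ → Sym2 HexVertex} {r : ℝ} {mr : ℝ → ℤ}
    (hPR : 0 < r ∧ D.carrier ∩ Metric.ball x r = {z : ℂ | x.im < z.im} ∩ Metric.ball x r ∧
      (∀ᶠ δ : ℝ in 𝓝[>] 0, e δ ∈ hexDomainBoundary (Λ δ) ∧
        Nonempty (HexMidEdgeSAW (Λ δ) (e δ) (b δ)) ∧
        (∀ v : HexVertex, (δ : ℂ) * hexCenter v ∈ Metric.ball x r → (v ∈ Λ δ ↔ mr δ ≤ v.1 1))) ∧
      Tendsto (fun δ : ℝ => (δ : ℂ) * hexMidpoint (e δ)) (𝓝[>] 0) (𝓝 x))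
    (hx : x ≠ D.pt 1)
    (hSup : ∀ K : Set ℂ, IsCompact K →
      K ⊆ D.carrier ∪ (({z : ℂ | z.im = (D.pt 1).im} ∩ Metric.ball (D.pt 1) ρ) ∪
        ({z : ℂ | z.im = x.im} ∩ Metric.ball x r)) → x ∉ K →
      ∃ C : ℝ, ∀ᶠ δ : ℝ in 𝓝[>] 0, ∀ z ∈ hexDomainMidEdges (Λ δ), (δ : ℂ) * hexMidpoint z ∈ K →
        ‖hexParafermionicObservable (Λ δ) (e δ) hexCriticalFugacity (5 / 8) z‖ ≤
          C * ‖hexParafermionicObservable (Λ δ) (e δ) hexCriticalFugacity (5 / 8) (b δ)‖) :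
    ∃ B : ℝ, 0 ≤ B ∧ ∀ᶠ δ : ℝ in 𝓝[>] 0, ∀ H : Site 2 → ℂ, IsPotential (Λ δ) (e δ) H →
      ∀ ub wb : HexVertex, b δ = s(ub, wb) →
      ∀ sb : Site 2, sb ∈ hexFaceVertices ub → sb ∈ hexFaceVertices wb →
      ∀ t : Site 2, mr δ ≤ t 1 → r / 2 < ‖(δ : ℂ) * triEmbed t - x‖ →
        ‖(δ : ℂ) * triEmbed t - x‖ ≤ r / 2 + δ →
        δ * ‖H t - H sb‖ ≤ B * ‖hexParafermionicObservable (Λ δ) (e δ) hexCriticalFugacity (5 / 8) (b δ)‖ := by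
  classical
  have hr : 0 < r := hPR.1
  obtain ⟨I, hI⟩ : ∃ I : Finset (ℤ × ℤ), I = ((Finset.Icc (-60 : ℤ) 60) ×ˢ (Finset.Icc (1 : ℤ) 60)).filter
      (fun ab => 44 ^ 2 ≤ ab.1 ^ 2 + ab.2 ^ 2 ∧ ab.1 ^ 2 + ab.2 ^ 2 ≤ 56 ^ 2) := ⟨_, rfl⟩
  have hmemI : ∀ ab : ℤ × ℤ, ab ∈ I ↔ ((-60 ≤ ab.1 ∧ ab.1 ≤ 60) ∧ 1 ≤ ab.2 ∧ ab.2 ≤ 60) ∧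
      44 ^ 2 ≤ ab.1 ^ 2 + ab.2 ^ 2 ∧ ab.1 ^ 2 + ab.2 ^ 2 ≤ 56 ^ 2 := fun ab => by
    rw [hI, Finset.mem_filter, Finset.mem_product, Finset.mem_Icc, Finset.mem_Icc]
  clear hI
  set zf : ℤ × ℤ → ℂ := fun ab => x + (r / 100 : ℝ) * ((ab.1 : ℂ) + (ab.2 : ℂ) * Complex.I) with hzf
  have key : ∀ ab : ℤ × ℤ, ∃ B : ℝ, 0 ≤ B ∧ (ab ∈ I → ∀ᶠ δ : ℝ in 𝓝[>] 0, ∀ H : Site 2 → ℂ,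
      IsPotential (Λ δ) (e δ) H → ∀ ub wb : HexVertex, b δ = s(ub, wb) →
      ∀ sb : Site 2, sb ∈ hexFaceVertices ub → sb ∈ hexFaceVertices wb →
      ∀ t : Site 2, mr δ ≤ t 1 → ‖(δ : ℂ) * triEmbed t - zf ab‖ ≤ r / 50 →
        δ * ‖H t - H sb‖ ≤
          B * ‖hexParafermionicObservable (Λ δ) (e δ) hexCriticalFugacity (5 / 8) (b δ)‖) := by
    rintro ⟨a, b'⟩
    by_cases hab : (a, b') ∈ I
    swap
    · exact ⟨0, le_rfl, fun h => absurd h hab⟩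
    suffices h : ∃ B : ℝ, 0 ≤ B ∧ ∀ᶠ δ : ℝ in 𝓝[>] 0, ∀ H : Site 2 → ℂ,
        IsPotential (Λ δ) (e δ) H → ∀ ub wb : HexVertex, b δ = s(ub, wb) →
        ∀ sb : Site 2, sb ∈ hexFaceVertices ub → sb ∈ hexFaceVertices wb →
        ∀ t : Site 2, mr δ ≤ t 1 → ‖(δ : ℂ) * triEmbed t - zf (a, b')‖ ≤ r / 50 →
          δ * ‖H t - H sb‖ ≤
            B * ‖hexParafermionicObservable (Λ δ) (e δ) hexCriticalFugacity (5 / 8) (b δ)‖ by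
      obtain ⟨B, hB, h⟩ := h
      exact ⟨B, hB, fun _ => h⟩
    obtain ⟨⟨⟨-, -⟩, hb1, -⟩, hlo, hhi⟩ := (hmemI _).1 hab
    have hsq : ‖(a : ℂ) + (b' : ℂ) * Complex.I‖ ^ 2 = (a : ℝ) ^ 2 + (b' : ℝ) ^ 2 := by
      rw [← Complex.normSq_eq_norm_sq]
      have := Complex.normSq_add_mul_I (a : ℝ) (b' : ℝ)
      push_cast at this ⊢
      exact this
    have hlo' : (44 : ℝ) ^ 2 ≤ ‖(a : ℂ) + (b' : ℂ) * Complex.I‖ ^ 2 := by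
      rw [hsq]; exact_mod_cast hlo
    have hhi' : ‖(a : ℂ) + (b' : ℂ) * Complex.I‖ ^ 2 ≤ (56 : ℝ) ^ 2 := by
      rw [hsq]; exact_mod_cast hhi
    have hn0 := norm_nonneg ((a : ℂ) + (b' : ℂ) * Complex.I)
    have hn1 : 44 ≤ ‖(a : ℂ) + (b' : ℂ) * Complex.I‖ := by nlinarith
    have hn2 : ‖(a : ℂ) + (b' : ℂ) * Complex.I‖ ≤ 56 := by nlinarith
    have hzx : ‖zf (a, b') - x‖ = r / 100 * ‖(a : ℂ) + (b' : ℂ) * Complex.I‖ := by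
      simp only [hzf, add_sub_cancel_left, norm_mul, Complex.norm_real, Real.norm_of_nonneg
        (by positivity : (0 : ℝ) ≤ r / 100)]
    refine rim_station hAF hPR hx hSup ?_ ?_ ?_
    · rw [hzx]; nlinarith
    · rw [hzx]; nlinarith
    · have hb1' : (1 : ℝ) ≤ b' := by exact_mod_cast hb1
      have him : (zf (a, b')).im = x.im + r / 100 * (b' : ℝ) := by
        simp [hzf, Complex.mul_im]
      rw [him]; nlinarith
  choose Bf hBf0 hBf using key
  refine ⟨∑ ab ∈ I, Bf ab, Finset.sum_nonneg fun ab _ => hBf0 ab, ?_⟩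
  have hall := (Filter.eventually_all_finset I).2 fun ab hab => hBf ab hab
  obtain ⟨_, _, hev, _, _⟩ := hAF
  have hframe := pinned_frame (Ω := D.carrier) (bf := e) hr (by positivity : (0 : ℝ) < r / 200)
    hPR.2.1 (hPR.2.2.1.mono fun δ h => h.2.2) (hPR.2.2.1.mono fun δ h => h.1)
    (hev.mono fun δ h => h.2.2.2.1) hPR.2.2.2
  have hδev : ∀ᶠ δ : ℝ in 𝓝[>] 0, δ ∈ Set.Ioo 0 (r / 100) := Ioo_mem_nhdsGT (by positivity)
  filter_upwards [hall, hframe, hδev] with δ hallδ hfrδ hδI H hH ub wb hb sb hsbu hsbw t ht1 h1 h2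
  obtain ⟨_, _, _, hht⟩ := hfrδ
  obtain ⟨hδ0, hδr⟩ := hδI
  -- the site `δ t` lies in the thin upper half-annulus
  have h3 : x.im - r / 200 ≤ ((δ : ℂ) * triEmbed t).im := by
    have htv : t = ![t 0, t 1] := by ext i; fin_cases i <;> simp
    rw [im_real_mul, htv, im_triEmbed_vec2]
    have hle : δ * ((mr δ : ℝ) * (Real.sqrt 3 / 2)) ≤ δ * ((t 1 : ℝ) * (Real.sqrt 3 / 2)) := by
      have : (mr δ : ℝ) ≤ t 1 := by exact_mod_cast ht1
      refine mul_le_mul_of_nonneg_left ?_ hδ0.le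
      exact mul_le_mul_of_nonneg_right this (by positivity)
    have := (abs_lt.1 hht).1
    linarith
  obtain ⟨a, b', ha1, ha2, hb1, hb2, hlo, hhi, hnear⟩ :=
    rim_cover _ _ _ hr h1 (h2.trans (by linarith)) h3
  have hab : (a, b') ∈ I := (hmemI _).2 ⟨⟨⟨ha1, ha2⟩, hb1, hb2⟩, hlo, hhi⟩
  have := hallδ (a, b') hab H hH ub wb hb sb hsbu hsbw t ht1 (by simpa only [hzf] using hnear)
  exact this.trans (mul_le_mul_of_nonneg_right
    (Finset.single_le_sum (fun ab _ => hBf0 ab) hab) (norm_nonneg _))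

/-! ### Lattice geometry at the exits -/

/-- A `𝕋`-neighbour is at embedded distance `≤ 1`. [folklore] -/
theorem norm_sub_le_one_of_mem_siteNbrs {s t : Site 2} (ht : t ∈ siteNbrs s) :
    ‖triEmbed t - triEmbed s‖ ≤ 1 := by
  have hz := norm_triZeta
  have h1 : ‖(1 : ℂ) - triZeta‖ = 1 := by
    have h3 : Real.sqrt 3 * Real.sqrt 3 = 3 := Real.mul_self_sqrt (by norm_num)
    have : Complex.normSq (1 - triZeta) = 1 := by
      rw [Complex.normSq_apply]; simp [triZeta_re, triZeta_im]; nlinarith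
    rw [← Real.sqrt_sq (norm_nonneg _), ← Complex.normSq_eq_norm_sq, this, Real.sqrt_one]
  simp only [siteNbrs, Finset.mem_insert, Finset.mem_singleton] at ht
  rcases ht with rfl | rfl | rfl | rfl | rfl | rfl
  · rw [triEmbed_add, triEmbed_single_zero]; simp
  · rw [triEmbed_sub, triEmbed_single_zero]; simp
  · rw [triEmbed_add, triEmbed_single_one]; simp [hz]
  · rw [triEmbed_sub, triEmbed_single_one]; simp [hz]
  · rw [triEmbed_add, triEmbed_triDiag]; simp [h1]
  · rw [triEmbed_sub, triEmbed_triDiag]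
    rw [show triEmbed s - (1 - triZeta) - triEmbed s = -((1 : ℂ) - triZeta) by ring, norm_neg, h1]

/-- The three faces of the flat-floor clauses at the cell `(k, M)` — the up-face, the face below and
the down-face of the cell — have centres within `2` of the site `![k, M]` and rows `M`, `M − 1`, `M`.
[folklore] -/
theorem floorFaces_near (k M : ℤ) :
    ‖hexCenter (upFace k M) - triEmbed ![k, M]‖ ≤ 2 ∧
    ‖hexCenter (belowFace k M) - triEmbed ![k, M]‖ ≤ 2 ∧
    ‖hexCenter (((![k, M], 1) : HexVertex)) - triEmbed ![k, M]‖ ≤ 2 := by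
  have hz := norm_triZeta
  have h3 : ‖(3 : ℂ)‖ = 3 := by simp
  have hA : ‖(1 : ℂ) + triZeta‖ ≤ 2 := by
    calc ‖(1 : ℂ) + triZeta‖ ≤ ‖(1 : ℂ)‖ + ‖triZeta‖ := norm_add_le _ _
      _ = 2 := by rw [norm_one, hz]; norm_num
  have hB : ‖(2 : ℂ) - triZeta‖ ≤ 3 := by
    calc ‖(2 : ℂ) - triZeta‖ ≤ ‖(2 : ℂ)‖ + ‖triZeta‖ := norm_sub_le _ _
      _ = 3 := by rw [Complex.norm_two, hz]; norm_num
  refine ⟨(cell_geometry k M).1.trans (by norm_num), ?_, ?_⟩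
  · have : hexCenter (belowFace k M) - triEmbed ![k, M] = (2 - triZeta) / 3 := by
      unfold belowFace
      simp only [hexCenter, triEmbed, Matrix.cons_val_zero, Matrix.cons_val_one, Fin.val_one,
        Nat.cast_one, Int.cast_sub, Int.cast_one, Matrix.cons_val_fin_one]
      ring
    rw [this, norm_div, h3]; linarith
  · have : hexCenter (((![k, M], 1) : HexVertex)) - triEmbed ![k, M] = 2 * (1 + triZeta) / 3 := by
      simp only [hexCenter, Fin.val_one, Nat.cast_one]; ring
    rw [this, norm_div, h3, norm_mul, Complex.norm_two]; linarith

end Summit.CriticalPhenomena.SAWScalingLimit.Theorems.PickHalfPlane.RootWedge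

end
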